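import Mathlib
import Summits.Ventures.HodgeRepro.Tier4.Target
import Summits.Ventures.HodgeRepro.Tier4.Line3.Defs
import Summits.Ventures.HodgeRepro.Tier4.Line3.QuarticProfile
import Summits.Ventures.HodgeRepro.Tier4.Line3.QuarticShapeOfCard
import Summits.Ventures.HodgeRepro.Tier4.Line3.WindowCentre
import Summits.Ventures.HodgeRepro.Tier4.Line3.QuarticUnitGap
import Summits.Ventures.HodgeRepro.Tier4.Line3.QuarticNormOne
import Summits.Ventures.HodgeRepro.Tier4.Line3.ScalarHodd

/-!
# Tier4/Line3/QuarticWindowReach — the quartic window is reached from every centre on every quartic CM field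

Blind re-derivation cell `pub-hodge-repro`, Tier 4 «PROVE THE STEP», LINE L3, seat t4-L3-p2 (g3): the composition of
C-L3-NORMONE (`exists_quartic_field_clauses`: the field clauses of the quartic window display), C-L3-HODD
(`exists_scaled_centre_hodd`: a common scalar puts the centre off the boundary) and C-L3-WINDOWCENTRE
(`exists_unitScaled_quarticWindow`: per-slot unit powers put it in the open window with the discriminant clause).

`exists_quarticWindow_reach` (statement shape = the planner's S14697): on a quartic CM field, for EVERY symmetric `J`-positive centre `xm` with wedge `≠ 0` and
`gram 0 1 ≠ 0` there are `η₀ > 1` with `UnitGap η₀` and `η₀² − 6η₀ + 1 ≤ 0`, a norm-one `w` with `‖τ₀ w‖² = η₀`,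
`‖σ w‖² = 1/η₀`, and a centre `xm' j = (λ · w^(k j)) • xm j` (`λ ≠ 0` common, `k 2 = k 0`, `k 3 = k 1`) with the four centre
clauses and the three clauses of the skeleton's `QuarticWindow xm' η₀` — the window-reachability clause of the line's
CENSUS-v0.51 §2 is a THEOREM in the quartic case, with no clause on the field and no clause on the base centre.

Nothing here says anything about the status of the Hodge conjecture for CM abelian varieties, which is NOT proved
(HC_CM is NOT proved by anyone in this repository).
-/

set_option autoImplicit false

noncomputable section

namespace Summit.Ventures.HodgeRepro.Tier4.Line3

open Summit.Ventures.HodgeRepro.Tier4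
open Matrix NumberField
open scoped ComplexConjugate
open scoped Classical

namespace T4Data

variable (X : T4Data)

/-- **THE QUARTIC WINDOW IS REACHED FROM EVERY CENTRE ON EVERY QUARTIC CM FIELD** (NORMONE ∘ HODD ∘ WINDOWCENTRE): the
statement in the shape the line's planner binds (STATUS S14697), the three window clauses spelled out as in WindowCentre. -/
theorem exists_quarticWindow_reach (h4 : Fintype.card (X.E →+* ℂ) = 4)
    {xm : X.Tuple} (h02 : xm 2 = xm 0) (h13 : xm 3 = xm 1)
    (hab : X.ballCoord (xm 0) 0 * X.ballCoord (xm 1) 1 - X.ballCoord (xm 0) 1 * X.ballCoord (xm 1) 0 ≠ 0)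
    (hpos : ∀ u v : ℂ, (u ≠ 0 ∨ v ≠ 0) →
      0 < (star (u • X.ballCoord (xm 0) + v • X.ballCoord (xm 1)) ⬝ᵥ
        (J *ᵥ (u • X.ballCoord (xm 0) + v • X.ballCoord (xm 1)))).re)
    (hB : X.gram xm 0 1 ≠ 0) :
    ∃ (η₀ : ℝ) (w lam : X.E) (e : Fin 4 → ℤ) (xm' : X.Tuple),
      1 < η₀ ∧ X.UnitGap η₀ ∧ η₀ ^ 2 - 6 * η₀ + 1 ≤ 0 ∧ w ≠ 0 ∧ |Algebra.norm ℚ w| = 1 ∧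
      ‖X.τ₀ w‖ ^ 2 = η₀ ∧ (∀ σ ∈ X.defEmb, ‖σ w‖ ^ 2 = 1 / η₀) ∧
      lam ≠ 0 ∧ e 2 = e 0 ∧ e 3 = e 1 ∧ (∀ j, xm' j = (lam * w ^ (e j)) • xm j) ∧
      xm' 2 = xm' 0 ∧ xm' 3 = xm' 1 ∧
      X.ballCoord (xm' 0) 0 * X.ballCoord (xm' 1) 1 - X.ballCoord (xm' 0) 1 * X.ballCoord (xm' 1) 0 ≠ 0 ∧
      (∀ u v : ℂ, (u ≠ 0 ∨ v ≠ 0) →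
        0 < (star (u • X.ballCoord (xm' 0) + v • X.ballCoord (xm' 1)) ⬝ᵥ
          (J *ᵥ (u • X.ballCoord (xm' 0) + v • X.ballCoord (xm' 1)))).re) ∧
      X.gram xm' 0 1 ≠ 0 ∧
      (∀ j, ∀ σ ∈ X.defEmb, 1 / η₀ < 2 * X.defQuad σ (xm' j) / X.tauSize (xm' j)) ∧
      (∀ j, ∀ σ ∈ X.defEmb, 2 * X.defQuad σ (xm' j) / X.tauSize (xm' j) < η₀) ∧
      (∀ j, ∀ σ ∈ X.defEmb,
        X.tauSize (xm' j) ^ 2 - 12 * X.tauSize (xm' j) * X.defQuad σ (xm' j) + 4 * X.defQuad σ (xm' j) ^ 2 < 0) := by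
  have hQ := X.quarticShape_of_card h4
  obtain ⟨η₀, w, hη, hgap, hη6, hw0, hN, hw1, hw2⟩ := X.exists_quartic_field_clauses h4
  obtain ⟨lam, xm'', hlam, hxm'', h02'', h13'', hab'', hpos'', hB'', hodd⟩ :=
    X.exists_scaled_centre_hodd hQ hη h02 h13 hab hpos hB
  obtain ⟨xm', ⟨e, he2, he3, he⟩, h02', h13', hab', hpos', hB', hr1, hr2, hdisc⟩ :=
    X.exists_unitScaled_quarticWindow hQ hw0 hη hη6 hw1 hw2 h02'' h13'' hab'' hpos'' hB'' hodd
  refine ⟨η₀, w, lam, e, xm', hη, hgap, hη6, hw0, hN, hw1, hw2, hlam, he2, he3, fun j => ?_,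
    h02', h13', hab', hpos', hB', hr1, hr2, hdisc⟩
  rw [he j, hxm'' j, smul_smul, mul_comm]

end T4Data

end Summit.Ventures.HodgeRepro.Tier4.Line3

end
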